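import Mathlib
import Literature.Probability.LatticeModels.ProdBernoulliIndependence
import Literature.Probability.Percolation.SharpnessDCTProofs
import Literature.Probability.Percolation.PercolationProofs
import Summits.CriticalPhenomena.PercolationContinuityZ3.Theorems.PercNearOneGluingNearOneGluingExposureDecomp
import HarnessLib

/-!
# Crux `PercNearOneGluing.NearOneGluing` (stmt-CriticalPhenomena-4574), line `SketchR2I5`
# (finger–Laplace identity) — stub `stub_noAttachAll` (no attached relay means `o ↮ A`)

Helper file for the crux skeleton `Cruxes/NearOneGluing/Lines/SketchR2I5.lean`
(lead prover-line-stmt-CriticalPhenomena-4574-c1-0, wave 1): proves exactly the registered stub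
`stub_noAttachAll`.  Lands with `--supports stmt-CriticalPhenomena-4574`.

Setting: bond configurations `ω : Set (Sym2 (Fin n))` under `μ = prodBernoulli w`; a relay set `A`,
a source `o ∉ A`; an abstract *pocket selector* `P` with `v ∈ P ω ↔ ω ∈ openConnIn (↑A)ᶜ o v`
(the relay-free pocket of `o`).

## Statement (`stub_noAttachAll`)

`Σ_T μ{P = T} · ∏_{a ∈ A} ∏_{x ∈ T} (1 − w s(x,a)) ≤ μ(o ↮ A)`.

## Proof

Fix `T`.  If `{P = T} = ∅` the term vanishes.  Otherwise `T ∩ A = ∅`, and with the attachment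
pairs `Att_T = {s(x, a) | x ∈ T, a ∈ A}` (an injective image of `T ×ˢ A`) and the event
`C_T = {all pairs of Att_T closed}` one has `μ(C_T) = ∏_{e ∈ Att_T} (1 − w e) = ∏_a ∏_x (1 − w s(x,a))`
(`prodBernoulli_real_forall_notMem`).  The event `{P = T}` is determined by the pairs `s(x, y)`,
`x ∈ T`, `y ∉ A` (`noAttachAll_determinedBy_pocket`: on it every vertex of `T` is joined to `o`
inside `T`, and the first exit of an open relay-free path from `T` is impossible), a pair set
disjoint from `Att_T`, so `μ({P = T} ∩ C_T) = μ{P = T} · μ(C_T)`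
(`prodBernoulli_real_inter_of_determinedBy_disjoint`).  The events `{P = T} ∩ C_T` are pairwise
disjoint in `T` and contained in `{o ↮ A}`: the first exit of an open `o–a` path from the pocket
goes to a relay through an open attachment pair (`exposureDecomp_exists_attached`).  Summing,
`Σ_T μ({P = T} ∩ C_T) = μ(⋃_T …) ≤ μ(o ↮ A)`.
-/

namespace Summit.CriticalPhenomena.PercolationContinuityZ3.Theorems

open MeasureTheory Set Literature.Probability.LatticeModels Literature.Probability.Percolation
open scoped Classical BigOperators

section NoAttachAllWalks

variable {n : ℕ} {A : Finset (Fin n)} {o : Fin n} {P : Set (Sym2 (Fin n)) → Finset (Fin n)}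

/-- **Locality of the pocket, relay-free form.** If `ω, ω'` agree on a pair set `F` containing
every pair `s(x, y)` with `x ∈ T` and `y ∉ A`, and `P ω = T`, then `P ω' = T`. -/
theorem noAttachAll_pocket_eq_of_inter_eq
    (hP : ∀ ω v, v ∈ P ω ↔ ω ∈ openConnIn ((↑A : Set (Fin n))ᶜ) o v) (ho : o ∉ A)
    {F : Finset (Sym2 (Fin n))} {T : Finset (Fin n)} (hF : ∀ x y, x ∈ T → y ∉ A → s(x, y) ∈ F)
    {ω ω' : Set (Sym2 (Fin n))} (h : ω ∩ ↑F = ω' ∩ ↑F) (hT : P ω = T) : P ω' = T := by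
  have hoT : o ∈ T := hT ▸ exposureDecomp_self_mem_pocket hP ho ω
  have hTA : Disjoint T A := hT ▸ exposureDecomp_pocket_disjoint hP ω
  have hK : (↑T : Set (Fin n)).sym2 ⊆ (↑F : Set (Sym2 (Fin n))) := by
    intro e he
    revert he
    induction e using Sym2.ind with
    | _ x y =>
      intro he
      obtain ⟨hx, hy⟩ := Set.mk_mem_sym2_iff.1 he
      exact Finset.mem_coe.2 (hF x y (Finset.mem_coe.1 hx)
        (fun hyA => Finset.disjoint_left.1 hTA (Finset.mem_coe.1 hy) hyA))
  ext v
  constructor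
  · intro hv
    by_contra hvT
    have hp : PathIn (openGraph ω') ((↑A : Set (Fin n))ᶜ) o v :=
      DCT16.pathIn_of_mem_openConnIn ((hP ω' v).1 hv)
    obtain ⟨x, y, hx, hy, hyA, hxy, -⟩ := hp.exit (R := (↑T : Set (Fin n)))
      (Finset.mem_coe.2 hoT) (fun h' => hvT (Finset.mem_coe.1 h'))
    rw [openGraph_adj] at hxy
    have hyA' : y ∉ A := fun h' => hyA (Finset.mem_coe.2 h')
    have heF : s(x, y) ∈ (↑F : Set (Sym2 (Fin n))) :=
      Finset.mem_coe.2 (hF x y (Finset.mem_coe.1 hx) hyA')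
    have heω : s(x, y) ∈ ω := (((Set.ext_iff.1 h) _).2 ⟨hxy.1, heF⟩).1
    have hxP : x ∈ P ω := by rw [hT]; exact Finset.mem_coe.1 hx
    have hyP : y ∈ P ω := exposureDecomp_pocket_step hP hxP heω hyA'
    rw [hT] at hyP
    exact hy (Finset.mem_coe.2 hyP)
  · intro hvT
    have hp : PathIn (openGraph ω) (↑T : Set (Fin n)) o v :=
      exposureDecomp_pathIn_of_pocket_eq hP ho hT hvT
    have hp' : PathIn (openGraph ω') (↑T : Set (Fin n)) o v :=
      DCT16.pathIn_congr_of_inter_eq hK h hp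
    refine (hP ω' v).2 (DCT16.mem_openConnIn_of_pathIn (hp'.mono fun u hu huA => ?_))
    exact Finset.disjoint_left.1 hTA (Finset.mem_coe.1 hu) (Finset.mem_coe.1 huA)

/-- **The event `{P = T}` is determined by the relay-free pairs meeting `T`**: any pair set
containing every `s(x, y)` with `x ∈ T`, `y ∉ A` determines it. -/
theorem noAttachAll_determinedBy_pocket
    (hP : ∀ ω v, v ∈ P ω ↔ ω ∈ openConnIn ((↑A : Set (Fin n))ᶜ) o v) (ho : o ∉ A)
    {F : Finset (Sym2 (Fin n))} (T : Finset (Fin n))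
    (hF : ∀ x y, x ∈ T → y ∉ A → s(x, y) ∈ F) :
    DeterminedBy {ω | P ω = T} (↑F : Set (Sym2 (Fin n))) := by
  rw [determinedBy_iff]
  intro ω ω' h
  exact ⟨fun hT => noAttachAll_pocket_eq_of_inter_eq hP ho hF h hT,
    fun hT => noAttachAll_pocket_eq_of_inter_eq hP ho hF h.symm hT⟩

/-- The cylinder event "all pairs of `E` are closed" is determined by `E`. -/
theorem noAttachAll_determinedBy_closed (E : Finset (Sym2 (Fin n))) :
    DeterminedBy {ω : Set (Sym2 (Fin n)) | ∀ e ∈ E, e ∉ ω} (↑E : Set (Sym2 (Fin n))) := by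
  rw [determinedBy_iff]
  intro ω ω' h
  simp only [mem_setOf_eq]
  refine forall₂_congr fun e he => not_congr ?_
  exact ⟨fun h1 => (((Set.ext_iff.1 h) e).1 ⟨h1, Finset.mem_coe.2 he⟩).1,
    fun h1 => (((Set.ext_iff.1 h) e).2 ⟨h1, Finset.mem_coe.2 he⟩).1⟩

/-- The attachment pairs `s(x, a)`, `x ∈ T`, `a ∈ A`, are an injective image of `T ×ˢ A` when
`T ∩ A = ∅`, so a product over them is the double product. -/
theorem noAttachAll_prod_attach (f : Sym2 (Fin n) → ℝ) {T A : Finset (Fin n)}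
    (hTA : Disjoint T A) :
    ∏ e ∈ (T ×ˢ A).image (fun p : Fin n × Fin n => s(p.1, p.2)), f e =
      ∏ a ∈ A, ∏ x ∈ T, f s(x, a) := by
  rw [Finset.prod_image, Finset.prod_product_right]
  rintro ⟨x, a⟩ hxa ⟨x', a'⟩ hxa' hEq
  have hx : x ∈ T := (Finset.mem_product.1 (Finset.mem_coe.1 hxa)).1
  have ha' : a' ∈ A := (Finset.mem_product.1 (Finset.mem_coe.1 hxa')).2
  have hEq' : s(x, a) = s(x', a') := hEq
  rcases Sym2.eq_iff.1 hEq' with ⟨rfl, rfl⟩ | ⟨rfl, rfl⟩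
  · rfl
  · exact absurd ha' (Finset.disjoint_left.1 hTA hx)

end NoAttachAllWalks

section NoAttachAllMain

/-- **Stub 2 of the line `SketchR2I5` (no attached relay means `o ↮ A`).** With `P` the
relay-free pocket selector (`v ∈ P ω ↔ o ↔ v inside (↑A)ᶜ`) and `o ∉ A`,
`Σ_T μ{P = T} · ∏_{a ∈ A} ∏_{x ∈ T} (1 − w s(x,a)) ≤ μ(o ↮ A)`.
Proof: `μ{P = T} · ∏_a ∏_x (1 − w s(x,a)) = μ({P = T} ∩ {all pairs s(x,a), x ∈ T, a ∈ A, closed})`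
(independence: `{P = T}` is determined by the pairs `s(x, y)`, `x ∈ T`, `y ∉ A`, disjoint from the
attachment pairs), this event is contained in `{o ↮ A}` (an open `o–a` path leaves the pocket
through an open attachment pair), and the events `{P = T}` are pairwise disjoint in `T`. -/
theorem stub_noAttachAll :
    ∀ (n : ℕ) (w : Sym2 (Fin n) → unitInterval) (A : Finset (Fin n)) (o : Fin n), o ∉ A →
      ∀ (P : Set (Sym2 (Fin n)) → Finset (Fin n)),
        (∀ ω v, v ∈ P ω ↔ ω ∈ openConnIn ((↑A : Set (Fin n))ᶜ) o v) →
        ∑ T : Finset (Fin n), (prodBernoulli w).real {ω | P ω = T} *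
            ∏ a ∈ A, ∏ x ∈ T, (1 - (w s(x, a) : ℝ)) ≤
          (prodBernoulli w).real (⋃ a ∈ A, openConn o a)ᶜ := by
  intro n w A o ho P hP
  -- attachment pairs of `T` and the event "no attachment pair is open"
  let Att : Finset (Fin n) → Finset (Sym2 (Fin n)) :=
    fun T => (T ×ˢ A).image (fun p : Fin n × Fin n => s(p.1, p.2))
  let C : Finset (Fin n) → Set (Set (Sym2 (Fin n))) := fun T => {ω | ∀ e ∈ Att T, e ∉ ω}
  have hAtt : ∀ (T : Finset (Fin n)) (x a : Fin n), x ∈ T → a ∈ A → s(x, a) ∈ Att T :=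
    fun T x a hx ha => Finset.mem_image.2 ⟨(x, a), Finset.mem_product.2 ⟨hx, ha⟩, rfl⟩
  -- per-`T` bound (an equality when `{P = T} ≠ ∅`)
  have hterm : ∀ T : Finset (Fin n),
      (prodBernoulli w).real {ω | P ω = T} * ∏ a ∈ A, ∏ x ∈ T, (1 - (w s(x, a) : ℝ)) ≤
        (prodBernoulli w).real ({ω | P ω = T} ∩ C T) := by
    intro T
    rcases Set.eq_empty_or_nonempty {ω : Set (Sym2 (Fin n)) | P ω = T} with hem | ⟨ω₀, hω₀⟩
    · rw [hem, Set.empty_inter, measureReal_empty, zero_mul]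
    have hPT : P ω₀ = T := hω₀
    have hTA : Disjoint T A := hPT ▸ exposureDecomp_pocket_disjoint hP ω₀
    -- the relay-free pairs meeting `T`
    let F : Finset (Sym2 (Fin n)) := Finset.univ.filter fun e : Sym2 (Fin n) =>
      ∃ x ∈ T, ∃ y ∉ A, e = s(x, y)
    have hFT : ∀ x y, x ∈ T → y ∉ A → s(x, y) ∈ F := fun x y hx hy =>
      Finset.mem_filter.2 ⟨Finset.mem_univ _, x, hx, y, hy, rfl⟩
    have hdisj : Disjoint F (Att T) := by
      refine Finset.disjoint_left.2 fun e heF heAtt => ?_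
      obtain ⟨-, x, hx, y, hy, rfl⟩ := Finset.mem_filter.1 heF
      obtain ⟨⟨x', a⟩, hxa, hEq⟩ := Finset.mem_image.1 heAtt
      have ha : a ∈ A := (Finset.mem_product.1 hxa).2
      have hEq' : s(x', a) = s(x, y) := hEq
      rcases Sym2.eq_iff.1 hEq' with ⟨rfl, rfl⟩ | ⟨rfl, rfl⟩
      · exact hy ha
      · exact Finset.disjoint_left.1 hTA hx ha
    have hdetP : DeterminedBy {ω | P ω = T} (↑F : Set (Sym2 (Fin n))) :=
      noAttachAll_determinedBy_pocket hP ho T hFT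
    have hdetC : DeterminedBy (C T) (↑(Att T) : Set (Sym2 (Fin n))) :=
      noAttachAll_determinedBy_closed (Att T)
    have hind : (prodBernoulli w).real ({ω | P ω = T} ∩ C T) =
        (prodBernoulli w).real {ω | P ω = T} * (prodBernoulli w).real (C T) :=
      prodBernoulli_real_inter_of_determinedBy_disjoint w hdisj hdetP hdetC
        MeasurableSet.of_discrete MeasurableSet.of_discrete
    have hCT : (prodBernoulli w).real (C T) = ∏ a ∈ A, ∏ x ∈ T, (1 - (w s(x, a) : ℝ)) := by
      rw [← noAttachAll_prod_attach (fun e => 1 - (w e : ℝ)) hTA]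
      exact prodBernoulli_real_forall_notMem w (Att T)
    rw [hind, hCT]
  -- the pieces are pairwise disjoint …
  have hpd : (↑(Finset.univ : Finset (Finset (Fin n))) : Set (Finset (Fin n))).PairwiseDisjoint
      (fun T => {ω | P ω = T} ∩ C T) := by
    intro T _ T' _ hTT'
    exact Set.disjoint_left.2 fun ω hω hω' => hTT' (hω.1.symm.trans hω'.1)
  -- … and contained in `{o ↮ A}`
  have hsub : (⋃ T ∈ (Finset.univ : Finset (Finset (Fin n))), ({ω | P ω = T} ∩ C T)) ⊆
      (⋃ a ∈ A, openConn o a)ᶜ := by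
    intro ω hω
    obtain ⟨T, -, hPT, hCω⟩ : ∃ T, T ∈ (Finset.univ : Finset (Finset (Fin n))) ∧
        ω ∈ {ω | P ω = T} ∩ C T := by
      simpa only [Set.mem_iUnion, exists_prop] using hω
    rw [Set.mem_compl_iff, Set.mem_iUnion₂]
    rintro ⟨a, haA, hoa⟩
    obtain ⟨y, hyA, x, hxP, hxy⟩ := exposureDecomp_exists_attached hP ho haA hoa
    have hPT' : P ω = T := hPT
    rw [hPT'] at hxP
    exact hCω (s(x, y)) (hAtt T x y hxP hyA) hxy
  calc ∑ T : Finset (Fin n), (prodBernoulli w).real {ω | P ω = T} *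
        ∏ a ∈ A, ∏ x ∈ T, (1 - (w s(x, a) : ℝ))
      ≤ ∑ T : Finset (Fin n), (prodBernoulli w).real ({ω | P ω = T} ∩ C T) :=
        Finset.sum_le_sum fun T _ => hterm T
    _ = (prodBernoulli w).real
          (⋃ T ∈ (Finset.univ : Finset (Finset (Fin n))), ({ω | P ω = T} ∩ C T)) :=
        (measureReal_biUnion_finset hpd (fun _ _ => MeasurableSet.of_discrete)).symm
    _ ≤ (prodBernoulli w).real (⋃ a ∈ A, openConn o a)ᶜ := measureReal_mono hsub

end NoAttachAllMain

end Summit.CriticalPhenomena.PercolationContinuityZ3.Theorems
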